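import Mathlib
import HarnessLib
import Summits.NavierStokesRegularity.NavierStokesRegularity.Theorems.TaylorModelRungThreeCertificateReadoutVInterpWinP

/-!
# Crux K1b-DR (stmt-NavierStokesRegularity-23954), line `taylor-model` — v3 WINDOWED read-outs: DIAGNOSTIC of the LANDED CENTRE versus the
# next ball's emitted base point (ns-tm-g4 g7; computable defs only — a MEASUREMENT for the replay driver, not a test of record)

Why: engine-1 j323486 (`checkReadoutStageWinDiagP'`, all 35 stages) shows the (R9p) mean-value term small (`mv ≪ slack` on stages ≥ 5)
but the CENTRE term `cenC_l = |ℓ_J l (land_j yc) − ctr_J l|` of order `0.7` on ≈ 1 200 faces, identical across the self-similar stages —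
a FRAME mismatch between the emitted data of ball `J = nx j` (base point `yb_J = xD J 0`, face centres `ctr_J = w·yb_J`, both mutually
consistent: `checkR0 = 1`) and K1b-DR's landing map `land_j y v (i,k) = Lv_J · (if k+1 ≤ Ka then y(i,k+1) else v_i) / |y(i₀,1)|`
(`CertTables.landF`), in which the kernel reads the landed centre.  THIS FILE MEASURES THE MISMATCH COORDINATEWISE, so the emitter can
read off the convention that differs (normalisation / shell shift / tail):

* `CertTables.diagLand T rw ybJ` — per window coordinate `c < n`: `(landBox(Z⁰c)_c.lo − ybJ_c, landBox(Z⁰c)_c.hi − ybJ_c)`, i.e. the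
  enclosure of `land_j(yc)_c − yb_{J,c}` for the centre crossing state `yc ∈ Z⁰c` (tails `|v| ≤ tv`, `Lv ∈ LvB`); a landed-state base
  point gives intervals around `0` of width ≈ the `Z⁰c` smear;
* `CertTables.diagLandNorm T rw ybJ` — the pair `(ybJ at (i₀,0), LvB)`: a landed state has `|component (i₀,0)| = Lv_J` exactly;
* `CertTablesV.checkReadoutStageWinDiagLand' / …DiagLandNorm'` — per stage, checkpoint form (`roInWin'`, `ybJ := xD (nx j) 0`).

HONEST FRAMING: replay instrumentation for the MODEL certificate №23954 (rung TL-M3); nothing here is a statement about the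
Navier–Stokes equations, and nothing is asserted.
-/

-- the sub-problem namespace repeats the summit name by design (D-0017)
set_option linter.dupNamespace false

namespace Summit.NavierStokesRegularity.NavierStokesRegularity.Theorems.TaylorModelCert

namespace CertTables

variable {K : Type} [Field K]

/-- **Landed centre minus the next base point, per window coordinate** (see the module docstring). [folklore] -/
def diagLand (T : CertTables K) (rw : ROInWin) (ybJ : Array Dyad) : Array (Dyad × Dyad) :=
  let ri := rw.base
  let LB0 := T.landBox ri.prec ri.LvB ri.tv (rw.Z0c T)
  Array.ofFn fun c : Fin T.n =>
    (Dyad.sub (IntervalD.aget LB0 c).lo (dget ybJ c), Dyad.sub (IntervalD.aget LB0 c).hi (dget ybJ c))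

/-- **Normalisation discriminator**: the next base point's `(i₀,0)` component and the enclosure of `Lv_J` (a landed state has
`|yb_J (i₀,0)| = Lv_J`). [folklore] -/
def diagLandNorm (T : CertTables K) (rw : ROInWin) (ybJ : Array Dyad) : Dyad × IntervalD :=
  (dget ybJ (T.idx T.i₀ 0), rw.base.LvB)

/-- **Parts of the centre-only box, per window coordinate** (appended, ns-tm-g4 g7): for `c < n` the 4-tuple
`(TPw_c, rem_c, MV_c, Z0c_c)` — the centre Taylor polynomial over the centre window `U0 = [u0lo, u0hi]`, the remainder half-width
`(J_c·[0,u0hi]^(p+1))↑`, the mean-value term `([MinW]·(pointBox(x) − x))_c` (should be `[0,0]`), and their sum `Z⁰c_c` — so that a wide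
`landBox(Z⁰c)` can be traced to its term. [folklore] -/
def diagZ0cParts (T : CertTables K) (rw : ROInWin) : Array (IntervalD × Dyad × IntervalD × IntervalD) :=
  let ri := rw.base
  let U0 : IntervalD := ⟨rw.u0lo, rw.u0hi⟩
  let TP := rw.TPw T U0
  let hp1 := IntervalD.powR ri.prec ⟨Dyad.ofInt 0, rw.u0hi⟩ (ri.p + 1)
  let MV := IntervalD.mulIV T.n ri.prec (rw.MinW T) (IntervalD.subIVD T.n ri.prec (IntervalD.pointBoxA T.n ri.x) ri.x)
  let Z := rw.Z0c T
  Array.ofFn fun c : Fin T.n =>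
    (IntervalD.aget TP c, (IntervalD.mulR ri.prec (IntervalD.ofDyad (dget ri.J c)) hp1).hi, IntervalD.aget MV c, IntervalD.aget Z c)

/-- **The landing box itself and its reciprocal factor** (appended): `(landBox(Z⁰c)_c for c < n, [1/|y_{i₀1}|] over Z⁰c, LvB)`. [folklore] -/
def diagLandBox (T : CertTables K) (rw : ROInWin) : Array IntervalD × IntervalD × IntervalD :=
  let ri := rw.base
  let Z := rw.Z0c T
  (T.landBox ri.prec ri.LvB ri.tv Z, IntervalD.invPos ri.prec (IntervalD.absBox (IntervalD.aget Z (T.idx T.i₀ 1))), ri.LvB)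

end CertTables

namespace CertTablesV

variable (TV : CertTablesV) (kitOf : ℕ → CoreKit) (wT : ℕ → Array Dyad) (A : ReadoutAux QS2) (WV : WindowsV)

/-- Per-stage landed-centre-versus-base-point table (checkpoint form; `J = nx j`, `ybJ = xD J 0`). [folklore] -/
def checkReadoutStageWinDiagLand' (j : ℕ) : Array (Dyad × Dyad) :=
  TV.base.diagLand (TV.roInWin' kitOf wT A WV j) (TV.xD (TV.base.stage j).nx 0)

/-- Per-stage normalisation discriminator (checkpoint form). [folklore] -/
def checkReadoutStageWinDiagLandNorm' (j : ℕ) : Dyad × IntervalD :=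
  TV.base.diagLandNorm (TV.roInWin' kitOf wT A WV j) (TV.xD (TV.base.stage j).nx 0)

/-- Per-stage parts of the centre-only box (checkpoint form; appended). [folklore] -/
def checkReadoutStageWinDiagZ0cParts' (j : ℕ) : Array (IntervalD × Dyad × IntervalD × IntervalD) :=
  TV.base.diagZ0cParts (TV.roInWin' kitOf wT A WV j)

/-- Per-stage landing box, reciprocal factor and `LvB` (checkpoint form; appended). [folklore] -/
def checkReadoutStageWinDiagLandBox' (j : ℕ) : Array IntervalD × IntervalD × IntervalD :=
  TV.base.diagLandBox (TV.roInWin' kitOf wT A WV j)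

end CertTablesV

end Summit.NavierStokesRegularity.NavierStokesRegularity.Theorems.TaylorModelCert
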